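import Summits.KontsevichZagierPeriods.KontsevichZagierPeriods.Theses.HurwitzMicroSectors
import Summits.KontsevichZagierPeriods.KontsevichZagierPeriods.Theorems.HurwitzMicroSectorsNormalFormPrinciplePiBoxTransfer
import Summits.KontsevichZagierPeriods.KontsevichZagierPeriods.Theorems.HurwitzMicroSectorsNormalFormPrincipleVariants2346
import Summits.KontsevichZagierPeriods.KontsevichZagierPeriods.Theorems.HurwitzMicroSectorsNormalFormPrincipleVariants2311

/-! TTRL-lite variant V2312 of stmt-KontsevichZagierPeriods-3869

Variant V2312 = `stub_boxRigidity` (the leaf `BoxRigidity` of `NormalFormPrinciple`: two representations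
on open unit boxes with integrands of KZ's rational shape `p/q` over `ℚ` and equal values are
KZ-equivalent) under the JOINT small-case move `bound_nat:m≤6; bound_nat:m'≤5` (hypotheses read in the
order `m' ≤ 5 → m ≤ 6`). Verdict of the attempt seat: **open** — this file is the exact-strength
certificate, not a proof of the variant. Writing `BoxVanishing K` for "every box-rational representation
on `(0,1)ᴷ` of value `0` is a relation", the tree's lemma `boxRigidityLe_iff_boxVanishing` (file
`…Variants2239`: a joint bound `m ≤ j, m' ≤ k` is BoxVanishing in the single dimension `max j k`) pins the
variant exactly: `V2312 ⟺ BoxVanishing 6` (`stub_boxRigidity_var2312_iff_boxVanishing_six`: `⇒` compare a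
vanishing box-rational representation on `(0,1)⁶` with the zero representation on the `0`-box, `0 ≤ 5`;
`⇐` pad both representations to the `6`-box by unit intervals and subtract there, value `0` by
soundness). Hence V2312 is the SAME statement as the recorded-open siblings V2311 (`fix_nat:m=6;
bound_nat:m'≤5`), V2346 (`bound_nat:m≤6; bound_nat:m'≤2`), V2302/V2310/V2313 (all `BoxVanishing 6`) and as
the two-sided bounded leaf `BoxRigidity(m, m' ≤ 6)` (`…_iff_var2311`, `…_iff_var2346`, `…_iff_le_six`);
reading the two bounds in the other order changes nothing (`…_iff_swap`). Downward it yields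
`BoxVanishing j` for every `j ≤ 6` (`boxVanishingLe_six_of_stub_boxRigidity_var2312`); upward it is implied
by `BoxVanishing 6` alone, by the parent leaf and by the Summit (`…_of_boxVanishing_six`, `…_of_parent`,
`…_of_statement`). Why open: `BoxVanishing 6 ⊇ BoxVanishing 5 ∋` "for `a b : ℚ`,
`a + b·ζ(5) = 0 ⇒ [a + b/(1 − x₁⋯x₅)]_{(0,1)⁵}` is a relation" (reachable today only through `ζ(5) ∉ ℚ`,
open), `⊇ BoxVanishing 3 ∋` the case split `ζ(3) ∈ ℚ + ℚπ²`, `⊇ BoxVanishing 2 ∋` Catalan's dichotomy;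
conversely `KontsevichZagierPeriods → V2312`, so a refutation of the variant would refute Conjecture 1 for
the tree's calculus, and the tree has no additive invariant of `KZ.relations` finer than `KZ.eval`
(soundness). The proved two-sided frontier is `max j k ≤ 1` (`boxRigidityLe_of_max_le_one`, Baker).
Source: M. Kontsevich, D. Zagier, *Periods* (2001), §1.2 Conjecture 1 and rules 1)–3). Pure proof file,
no definitions. -/

-- `Summit.<Summit>.<Problem>` is the tree's mandated summit-side namespace (CONVENTIONS §2); for this
-- single-conjunct summit the two coincide, so the duplicate is deliberate.
set_option linter.dupNamespace false

noncomputable section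

namespace Summit.KontsevichZagierPeriods.KontsevichZagierPeriods.Theorems

open MeasureTheory Set
open Literature.NumberTheory.Transcendental Literature.NumberTheory.Transcendental.KZ
open Summit.KontsevichZagierPeriods.KontsevichZagierPeriods.Theses.HurwitzMicroSectors
open Summit.KontsevichZagierPeriods.HurwitzMicroSectors.NormalFormPrinciple.PiBox

/-! ## The variant V2312 itself: exactly `BoxVanishing 6` -/

/-- **V2312 ⟺ `BoxVanishing 6`** (every box-rational representation on `(0,1)⁶` of value `0` is a
relation): `⇒` compare a vanishing box-rational representation on `(0,1)⁶` (left slot, `m = 6 ≤ 6`) with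
the zero representation on the `0`-box (right slot, `m' = 0 ≤ 5`), itself a relation
(`boxVanishing_of_boxRigidityLe`); `⇐` pad both representations to `(0,1)⁶` and subtract on the common
box, value `0` by soundness (`boxRigidityLe_of_boxVanishing`, `5 ≤ 6`). This is the instance
`(j, k) = (6, 5)`, `max 6 5 = 6`, of `boxRigidityLe_iff_boxVanishing`.
[cite: KontsevichZagier2001, §1.2 Conjecture 1] -/
theorem stub_boxRigidity_var2312_iff_boxVanishing_six :
    (∀ (m m' : ℕ) (N : IntegralRep m) (N' : IntegralRep m'), m' ≤ 5 → m ≤ 6 → N.domain = {x | ∀ i, x i ∈ Set.Ioo (0:ℝ) 1} → N.IsRational → N'.domain = {x | ∀ i, x i ∈ Set.Ioo (0:ℝ) 1} → N'.IsRational → N.value = N'.value → Equivalent N N') ↔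
    (∀ N : IntegralRep 6, N.domain = {x | ∀ i, x i ∈ Set.Ioo (0:ℝ) 1} → N.IsRational →
      N.value = 0 → of N ∈ relations) :=
  ⟨fun h => boxVanishing_of_boxRigidityLe (j := 6) (k := 5) (K := 6) le_rfl h,
    fun hvan => boxRigidityLe_of_boxVanishing (j := 6) (k := 5) (K := 6) le_rfl (by norm_num) hvan⟩

/-- **V2312 ⟺ the sibling V2311** (`fix_nat:m=6; bound_nat:m'≤5`: freezing the left dimension to `6`
instead of bounding it by `6` loses nothing, by padding): both are `BoxVanishing 6`
(`stub_boxRigidity_var2311_iff_boxVanishing_six`). [cite: KontsevichZagier2001, §1.2 Conjecture 1] -/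
theorem stub_boxRigidity_var2312_iff_var2311 :
    (∀ (m m' : ℕ) (N : IntegralRep m) (N' : IntegralRep m'), m' ≤ 5 → m ≤ 6 → N.domain = {x | ∀ i, x i ∈ Set.Ioo (0:ℝ) 1} → N.IsRational → N'.domain = {x | ∀ i, x i ∈ Set.Ioo (0:ℝ) 1} → N'.IsRational → N.value = N'.value → Equivalent N N') ↔
    (∀ (m' : ℕ) (N : IntegralRep 6) (N' : IntegralRep m'), m' ≤ 5 →
      N.domain = {x | ∀ i, x i ∈ Set.Ioo (0:ℝ) 1} → N.IsRational →
      N'.domain = {x | ∀ i, x i ∈ Set.Ioo (0:ℝ) 1} → N'.IsRational →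
      N.value = N'.value → Equivalent N N') := by
  rw [stub_boxRigidity_var2312_iff_boxVanishing_six, stub_boxRigidity_var2311_iff_boxVanishing_six]

/-- **V2312 ⟺ the sibling V2346** (`bound_nat:m≤6; bound_nat:m'≤2`, read `m ≤ 6 → m' ≤ 2`): the bound on
the right dimension is idle next to `m ≤ 6`, both variants being `BoxVanishing 6`
(`stub_boxRigidity_var2346_iff_boxVanishing_six`). [cite: KontsevichZagier2001, §1.2 Conjecture 1] -/
theorem stub_boxRigidity_var2312_iff_var2346 :
    (∀ (m m' : ℕ) (N : IntegralRep m) (N' : IntegralRep m'), m' ≤ 5 → m ≤ 6 → N.domain = {x | ∀ i, x i ∈ Set.Ioo (0:ℝ) 1} → N.IsRational → N'.domain = {x | ∀ i, x i ∈ Set.Ioo (0:ℝ) 1} → N'.IsRational → N.value = N'.value → Equivalent N N') ↔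
    (∀ (m m' : ℕ) (N : IntegralRep m) (N' : IntegralRep m'), m ≤ 6 → m' ≤ 2 →
      N.domain = {x | ∀ i, x i ∈ Set.Ioo (0:ℝ) 1} → N.IsRational →
      N'.domain = {x | ∀ i, x i ∈ Set.Ioo (0:ℝ) 1} → N'.IsRational →
      N.value = N'.value → Equivalent N N') := by
  rw [stub_boxRigidity_var2312_iff_boxVanishing_six, stub_boxRigidity_var2346_iff_boxVanishing_six]

/-- **V2312 ⟺ `BoxRigidity` for all `m, m' ≤ 6`** (the honest strength of the variant: Conjecture 1 for
all pairs of rational integrands over `ℚ` on the open unit boxes of dimension at most `6` — among these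
periods `π²`, `π⁴`, `π⁶`, `ζ(3)`, `ζ(5)`, `ζ(3)²`, Catalan's `G`, `log`-products and every multiple zeta
value of weight `≤ 6`; bounding `m' ≤ 5` rather than `≤ 6` loses nothing, by padding).
[cite: KontsevichZagier2001, §1.2 Conjecture 1] -/
theorem stub_boxRigidity_var2312_iff_le_six :
    (∀ (m m' : ℕ) (N : IntegralRep m) (N' : IntegralRep m'), m' ≤ 5 → m ≤ 6 → N.domain = {x | ∀ i, x i ∈ Set.Ioo (0:ℝ) 1} → N.IsRational → N'.domain = {x | ∀ i, x i ∈ Set.Ioo (0:ℝ) 1} → N'.IsRational → N.value = N'.value → Equivalent N N') ↔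
    (∀ (m m' : ℕ) (N : IntegralRep m) (N' : IntegralRep m'), m ≤ 6 → m' ≤ 6 →
      N.domain = {x | ∀ i, x i ∈ Set.Ioo (0:ℝ) 1} → N.IsRational →
      N'.domain = {x | ∀ i, x i ∈ Set.Ioo (0:ℝ) 1} → N'.IsRational →
      N.value = N'.value → Equivalent N N') := by
  rw [stub_boxRigidity_var2312_iff_var2311]
  exact stub_boxRigidity_var2311_iff_le_six

/-- **Reading the two bounds in the other order changes nothing**: V2312 (`m' ≤ 5 → m ≤ 6`) ⟺ the same
leaf with the hypotheses swapped (`m ≤ 6 → m' ≤ 5`). [cite: KontsevichZagier2001, §1.2 Conjecture 1] -/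
theorem stub_boxRigidity_var2312_iff_swap :
    (∀ (m m' : ℕ) (N : IntegralRep m) (N' : IntegralRep m'), m' ≤ 5 → m ≤ 6 → N.domain = {x | ∀ i, x i ∈ Set.Ioo (0:ℝ) 1} → N.IsRational → N'.domain = {x | ∀ i, x i ∈ Set.Ioo (0:ℝ) 1} → N'.IsRational → N.value = N'.value → Equivalent N N') ↔
    (∀ (m m' : ℕ) (N : IntegralRep m) (N' : IntegralRep m'), m ≤ 6 → m' ≤ 5 →
      N.domain = {x | ∀ i, x i ∈ Set.Ioo (0:ℝ) 1} → N.IsRational →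
      N'.domain = {x | ∀ i, x i ∈ Set.Ioo (0:ℝ) 1} → N'.IsRational →
      N.value = N'.value → Equivalent N N') :=
  ⟨fun h m m' N N' hm hm' => h m m' N N' hm' hm, fun h m m' N N' hm' hm => h m m' N N' hm hm'⟩

/-! ## Consequences downward, and the variant from above -/

/-- **V2312 ⇒ `BoxVanishing` in every dimension `≤ 6`** (monotonicity of BoxVanishing along padding,
`boxVanishing_mono`): in particular the dimension-`5` statement containing the `ζ(5)` dichotomy, the
dimension-`3` one (`ζ(3)` against `ℚ + ℚπ²`… inside the calculus) and the dimension-`2` one (Catalan).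
[cite: KontsevichZagier2001, §1.2 Conjecture 1] -/
theorem boxVanishingLe_six_of_stub_boxRigidity_var2312
    (h : ∀ (m m' : ℕ) (N : IntegralRep m) (N' : IntegralRep m'), m' ≤ 5 → m ≤ 6 → N.domain = {x | ∀ i, x i ∈ Set.Ioo (0:ℝ) 1} → N.IsRational → N'.domain = {x | ∀ i, x i ∈ Set.Ioo (0:ℝ) 1} → N'.IsRational → N.value = N'.value → Equivalent N N') :
    ∀ (m : ℕ) (N : IntegralRep m), m ≤ 6 → N.domain = {x | ∀ i, x i ∈ Set.Ioo (0:ℝ) 1} →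
      N.IsRational → N.value = 0 → of N ∈ relations :=
  fun _ N hm => boxVanishing_mono hm (stub_boxRigidity_var2312_iff_boxVanishing_six.1 h) N

/-- **`BoxVanishing 6` alone already proves V2312** (the honest residual of the variant, stated as the
missing lemma: whoever settles Conjecture 1 for vanishing box-rational periods of dimension `6` settles
V2312, and conversely). [cite: KontsevichZagier2001, §1.2 Conjecture 1] -/
theorem stub_boxRigidity_var2312_of_boxVanishing_six
    (hvan : ∀ N : IntegralRep 6, N.domain = {x | ∀ i, x i ∈ Set.Ioo (0:ℝ) 1} → N.IsRational →
      N.value = 0 → of N ∈ relations) :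
    ∀ (m m' : ℕ) (N : IntegralRep m) (N' : IntegralRep m'), m' ≤ 5 → m ≤ 6 → N.domain = {x | ∀ i, x i ∈ Set.Ioo (0:ℝ) 1} → N.IsRational → N'.domain = {x | ∀ i, x i ∈ Set.Ioo (0:ℝ) 1} → N'.IsRational → N.value = N'.value → Equivalent N N' :=
  stub_boxRigidity_var2312_iff_boxVanishing_six.2 hvan

/-- **The parent leaf ⇒ V2312** (the variant is a specialisation of `stub_boxRigidity`: both bounds are
simply dropped; the converse is not claimed — the parent is `BoxVanishing` in ALL dimensions).
[cite: KontsevichZagier2001, §1.2 Conjecture 1] -/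
theorem stub_boxRigidity_var2312_of_parent
    (h : ∀ (m m' : ℕ) (N : IntegralRep m) (N' : IntegralRep m'), N.domain = {x | ∀ i, x i ∈ Set.Ioo (0:ℝ) 1} → N.IsRational → N'.domain = {x | ∀ i, x i ∈ Set.Ioo (0:ℝ) 1} → N'.IsRational → N.value = N'.value → Equivalent N N') :
    ∀ (m m' : ℕ) (N : IntegralRep m) (N' : IntegralRep m'), m' ≤ 5 → m ≤ 6 → N.domain = {x | ∀ i, x i ∈ Set.Ioo (0:ℝ) 1} → N.IsRational → N'.domain = {x | ∀ i, x i ∈ Set.Ioo (0:ℝ) 1} → N'.IsRational → N.value = N'.value → Equivalent N N' :=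
  fun m m' N N' _ _ => h m m' N N'

/-- **`KontsevichZagierPeriods ⇒ V2312`**: the variant is a special case of Conjecture 1 for the tree's
calculus (`leaves_of_statement`) — so a refutation of the variant would refute the Summit.
[cite: KontsevichZagier2001, §1.2 Conjecture 1] -/
theorem stub_boxRigidity_var2312_of_statement (h : _root_.KontsevichZagierPeriods) :
    ∀ (m m' : ℕ) (N : IntegralRep m) (N' : IntegralRep m'), m' ≤ 5 → m ≤ 6 → N.domain = {x | ∀ i, x i ∈ Set.Ioo (0:ℝ) 1} → N.IsRational → N'.domain = {x | ∀ i, x i ∈ Set.Ioo (0:ℝ) 1} → N'.IsRational → N.value = N'.value → Equivalent N N' :=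
  stub_boxRigidity_var2312_of_parent (leaves_of_statement h).1

end Summit.KontsevichZagierPeriods.KontsevichZagierPeriods.Theorems

end
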